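import Literature.NumberTheory.LFunctions.ConreyIwaniec2002Thm61ShiftedPieces
import HarnessLib

/-!
# Conrey–Iwaniec (2002), Theorem 6.1, (6.27): the separated pieces (trivial bounds)

B. Conrey, H. Iwaniec, Acta Arith. 103 (2002), §6 (6.27) [held text `paper:arxiv-math_0111012`,
p0015:L63–80]: "If these segments are separated then they produce nothing from the sum nor from the
integral in (6.27) unless `Y₁, Y₂ ≤ √2 h`. In this case we estimate trivially by
`Σ_{n ≤ 2h}|a_{n+h}a_n|(n/hT)² ≤ Σ_{n≤3h}|a_n|²(n/hT)² ≪ T⁻²h(log 3h)³` which yields the third error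
term in (6.27). Moreover, the integral over `x ≤ 2h` is estimated similarly by
`∫₀^{2h}|a(x+h)a(x)|(x/hT)²dx ≤ ∫₀^{3h}|a(y)|²(y/hT)²dy ≪ T⁻²h` which yields the second error term."

Here, with the `ρ`-adic partition (`ρ = 9/8`) of `ConreyIwaniec2002Thm61Partition` inserted in
`m = n + h`: if `ρ^N ≤ 12h`, the block `Σ_{k<N} η_k(n+h) = ψ_ρ(ρ(n+h)/ρ^N)` lives on `n + h < 12h`,
and with `|L(v)| ≤ v⁻²` (6.3), `|a| ≤ 1` (6.14), `|λ| ≤ τ` (6.15), `Σ_{n≤x}τ(n)² ≤ x(1+log x)³`: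
`|Σ_n λ(n+h)a(n+h)conj(λ(n)a(n))L(hT/n)·Σ_{k<N}η_k(n+h)| ≤ 121T⁻²·12h(1+log 12h)³`
(`small_block_sum_bound`) and `|∫₀^∞ a(x+h)ā(x)L(hT/x)Σ_{k<N}η_k(x+h)dx| ≤ 121T⁻²·11h`
(`small_block_integral_bound`).

PROVED HERE (namespace `ConreyIwaniec2002.Thm61ShiftedPieces`, continued), no `sorry`, no `def`;
for the registered stub S2b `stub_thm61_shifted` of SKELETON P64 (line `thm61-cm-convolution`).

## References
* [ConreyIwaniec2002] B. Conrey, H. Iwaniec, Acta Arith. 103 (2002) 259–312: §6 (6.3), (6.14),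
  (6.15), (6.27).
-/

noncomputable section

open Set Filter MeasureTheory
open scoped Topology

namespace Literature.NumberTheory.LFunctions

namespace ConreyIwaniec2002

namespace Thm61ShiftedPieces

open Thm61Partition Thm61Bumps Thm61ShiftedArith

section Small

variable {ρ : ℝ} (hρ : ρ = 9 / 8) {K : ℝ → ℝ} (hK : IsCIKernel K)
  {lam : ℕ → ℂ} (hlam : ∀ n : ℕ, 1 ≤ n → ‖lam n‖ ≤ (Nat.divisors n).card)
  {T Y : ℝ} {a : ℝ → ℂ} (hT : 1 ≤ T) (hY : 2 ≤ Y) (ha : IsCutoff14 a Y) (ha0 : a 0 = 0)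
  {h : ℕ} (hh : 1 ≤ h)

/-! ### The separated pieces: trivial bounds -/

include hY ha in
/-- `|a(y)| ≤ 1` on `y > 0`. [cite: ConreyIwaniec2002, §6 (6.14)] -/
theorem norm_a_le_one {y : ℝ} (hy : 0 < y) : ‖a y‖ ≤ 1 := by
  have hY0 : 0 < Y := by linarith
  have h0 := ha.2 0 (by norm_num) y hy
  rw [pow_zero, one_mul, iteratedDeriv_zero] at h0
  have : 0 ≤ y / Y := by positivity
  exact h0.trans (inv_le_one_of_one_le₀ (one_le_pow₀ (by linarith)))

include hK hT hh in
/-- `|L(hT/x)| ≤ 121/T²` for `0 < x ≤ 11h` (`|L(v)| ≤ v⁻²`). [cite: ConreyIwaniec2002, §6 (6.3), (6.27)] -/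
theorem abs_ciL_le_small {x : ℝ} (hx : 0 < x) (hxL : x ≤ 11 * h) :
    |ciL K (h * T / x)| ≤ 121 / T ^ 2 := by
  have hh0 : (0:ℝ) < h := by exact_mod_cast hh
  have hT0 : 0 < T := by linarith
  have hv : 0 < (h : ℝ) * T / x := by positivity
  refine (Thm61OffDiagSeries.abs_ciL_le_inv_sq hK hv).trans ?_
  rw [div_pow, inv_div, div_le_div_iff₀ (by positivity) (by positivity)]
  have : x ^ 2 ≤ (11 * h) ^ 2 := pow_le_pow_left₀ hx.le hxL 2
  nlinarith [pow_pos hT0 2, pow_pos hh0 2]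

include hK hlam hT hY ha hh in
/-- The trivial bound for the summand of `S*(h)` on `1 ≤ n ≤ 11h`:
`|λ(n+h)a(n+h)conj(λ(n)a(n))L(hT/n)| ≤ 121T⁻²·τ(n+h)τ(n)`. [cite: ConreyIwaniec2002, §6 (6.27)] -/
theorem norm_term_le_small {n : ℕ} (hn1 : 1 ≤ n) (hn : n ≤ 11 * h) :
    ‖lam (n + h) * a ((n : ℝ) + h) * starRingEnd ℂ (lam n * a n) * (ciL K (h * T / n) : ℂ)‖ ≤
      121 / T ^ 2 * (((Nat.divisors (n + h)).card : ℝ) * (Nat.divisors n).card) := by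
  have hn0 : (0:ℝ) < n := by exact_mod_cast hn1
  have hh0 : (0:ℝ) < h := by exact_mod_cast hh
  have hnL : (n : ℝ) ≤ 11 * h := by exact_mod_cast hn
  have e : ‖lam (n + h) * a ((n : ℝ) + h) * starRingEnd ℂ (lam n * a n) * (ciL K (h * T / n) : ℂ)‖ =
      ‖lam (n + h)‖ * ‖a ((n : ℝ) + h)‖ * (‖lam n‖ * ‖a n‖) * |ciL K (h * T / n)| := by
    rw [norm_mul, norm_mul, norm_mul, Complex.norm_conj, norm_mul, Complex.norm_real,
      Real.norm_eq_abs]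
  rw [e]
  have h1 : ‖lam (n + h)‖ ≤ (Nat.divisors (n + h)).card := hlam (n + h) (by omega)
  have h2 : ‖a ((n : ℝ) + h)‖ ≤ 1 := norm_a_le_one hY ha (by positivity)
  have h3 : ‖lam n‖ ≤ (Nat.divisors n).card := hlam n hn1
  have h4 : ‖a n‖ ≤ 1 := norm_a_le_one hY ha hn0
  have h5 : |ciL K (h * T / n)| ≤ 121 / T ^ 2 := abs_ciL_le_small hK hT hh hn0 hnL
  calc ‖lam (n + h)‖ * ‖a ((n : ℝ) + h)‖ * (‖lam n‖ * ‖a n‖) * |ciL K (h * T / n)|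
      ≤ (Nat.divisors (n + h)).card * 1 * ((Nat.divisors n).card * 1) * (121 / T ^ 2) := by
        gcongr
    _ = 121 / T ^ 2 * (((Nat.divisors (n + h)).card : ℝ) * (Nat.divisors n).card) := by ring

include hρ hh in
/-- The weight of the block of separated pieces at `y ≥ 1`: `Σ_{k<N} η_k(y) = ψ_ρ(ρy/ρ^N) ∈ [0,1]`,
and `= 0` once `y ≥ ρ^N`. [cite: ConreyIwaniec2002, §6 (6.27)] -/
theorem block_weight {N : ℕ} {x : ℝ} (hx : 0 ≤ x) :
    |∑ k ∈ Finset.range N, plateau ρ (ρ ^ k / ρ) (ρ ^ k) (x + h)| ≤ 1 ∧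
      (ρ ^ N ≤ x + h → ∑ k ∈ Finset.range N, plateau ρ (ρ ^ k / ρ) (ρ ^ k) (x + h) = 0) := by
  obtain ⟨hρ1, -, -, -, -⟩ := rho_facts hρ
  have h1 : (1:ℝ) ≤ x + h := by
    have : (1:ℝ) ≤ h := by exact_mod_cast hh
    linarith
  refine ⟨?_, fun hN => sum_range_plateau_eq_zero hρ1 h1 hN⟩
  rw [sum_range_plateau_of_one_le hρ1 N h1, abs_of_nonneg (psi_nonneg _ _)]
  exact psi_le_one _ _

include hρ hK hlam hT hY ha ha0 hh in
/-- **The block of separated pieces of the sum** (third error term of (6.27)): if `ρ^N ≤ 12h` then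
`|Σ_n λ(n+h)a(n+h)conj(λ(n)a(n))L(hT/n)·Σ_{k<N}η_k(n+h)| ≤ 121T⁻²·12h(1+log 12h)³`.
[cite: ConreyIwaniec2002, §6 (6.27)] -/
theorem small_block_sum_bound {N : ℕ} (hN : ρ ^ N ≤ 12 * h) :
    ‖∑' n : ℕ, lam (n + h) * a ((n : ℝ) + h) * starRingEnd ℂ (lam n * a n) *
        (ciL K (h * T / n) : ℂ) *
        ((∑ k ∈ Finset.range N, plateau ρ (ρ ^ k / ρ) (ρ ^ k) ((n : ℝ) + h) : ℝ) : ℂ)‖ ≤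
      121 / T ^ 2 * (12 * h * (1 + Real.log (12 * h)) ^ 3) := by
  have hT0 : 0 < T := by linarith
  have hw0 : ∀ n : ℕ, 11 * h < n →
      ∑ k ∈ Finset.range N, plateau ρ (ρ ^ k / ρ) (ρ ^ k) ((n : ℝ) + h) = 0 := by
    intro n hn
    refine (block_weight hρ hh (Nat.cast_nonneg n)).2 ?_
    have : (11 * h : ℝ) + 1 ≤ n := by exact_mod_cast hn
    linarith
  rw [tsum_eq_sum (s := Finset.Icc 1 (11 * h)) ?_]
  · calc ‖∑ n ∈ Finset.Icc 1 (11 * h), lam (n + h) * a ((n : ℝ) + h) *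
            starRingEnd ℂ (lam n * a n) * (ciL K (h * T / n) : ℂ) *
            ((∑ k ∈ Finset.range N, plateau ρ (ρ ^ k / ρ) (ρ ^ k) ((n : ℝ) + h) : ℝ) : ℂ)‖
        ≤ ∑ n ∈ Finset.Icc 1 (11 * h), ‖lam (n + h) * a ((n : ℝ) + h) *
            starRingEnd ℂ (lam n * a n) * (ciL K (h * T / n) : ℂ) *
            ((∑ k ∈ Finset.range N, plateau ρ (ρ ^ k / ρ) (ρ ^ k) ((n : ℝ) + h) : ℝ) : ℂ)‖ :=
          norm_sum_le _ _
      _ ≤ ∑ n ∈ Finset.Icc 1 (11 * h),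
            121 / T ^ 2 * (((Nat.divisors (n + h)).card : ℝ) * (Nat.divisors n).card) := by
          refine Finset.sum_le_sum fun n hn => ?_
          rw [Finset.mem_Icc] at hn
          rw [norm_mul, Complex.norm_real, Real.norm_eq_abs]
          calc _ ≤ 121 / T ^ 2 * (((Nat.divisors (n + h)).card : ℝ) * (Nat.divisors n).card) * 1 :=
                mul_le_mul (norm_term_le_small hK hlam hT hY ha hh hn.1 hn.2)
                  (block_weight hρ hh (Nat.cast_nonneg n)).1 (abs_nonneg _) (by positivity)
            _ = _ := mul_one _
      _ = 121 / T ^ 2 * ∑ n ∈ Finset.Icc 1 (11 * h),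
            ((Nat.divisors (n + h)).card : ℝ) * (Nat.divisors n).card := by rw [Finset.mul_sum]
      _ ≤ 121 / T ^ 2 * (((11 * h + h : ℕ) : ℝ) * (1 + Real.log ((11 * h + h : ℕ) : ℝ)) ^ 3) :=
          mul_le_mul_of_nonneg_left (sum_tau_shift_mul_le (11 * h) h) (by positivity)
      _ = 121 / T ^ 2 * (12 * h * (1 + Real.log (12 * h)) ^ 3) := by
          have e : ((11 * h + h : ℕ) : ℝ) = 12 * h := by push_cast; ring
          rw [e]
  · intro n hn
    rw [Finset.mem_Icc, not_and_or, not_le, not_le] at hn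
    rcases hn with hn | hn
    · have : n = 0 := by omega
      subst this
      simp [ha0]
    · rw [hw0 n hn]; simp

include hρ hK hT hY ha hh in
/-- **The block of separated pieces of the integral** (second error term of (6.27)): if
`ρ^N ≤ 12h` then `|∫₀^∞ a(x+h)ā(x)L(hT/x)·Σ_{k<N}η_k(x+h)dx| ≤ 121T⁻²·11h`.
[cite: ConreyIwaniec2002, §6 (6.27)] -/
theorem small_block_integral_bound {N : ℕ} (hN : ρ ^ N ≤ 12 * h) :
    ‖∫ x in Ioi (0:ℝ), a (x + h) * starRingEnd ℂ (a x) * (ciL K (h * T / x) : ℂ) *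
        ((∑ k ∈ Finset.range N, plateau ρ (ρ ^ k / ρ) (ρ ^ k) (x + h) : ℝ) : ℂ)‖ ≤
      121 / T ^ 2 * (11 * h) := by
  have hT0 : 0 < T := by linarith
  have hh0 : (0:ℝ) < h := by exact_mod_cast hh
  have hw0 : ∀ x : ℝ, 0 ≤ x → 11 * h < x →
      ∑ k ∈ Finset.range N, plateau ρ (ρ ^ k / ρ) (ρ ^ k) (x + h) = 0 :=
    fun x hx hxL => (block_weight hρ hh hx).2 (by linarith)
  refine norm_integral_Ioi_le_of_support (by positivity) (fun x hx => ?_)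
    (fun x hx => by rw [hw0 x (by linarith) hx]; simp)
  by_cases hxL : x ≤ 11 * h
  · have hG : ‖a (x + h) * starRingEnd ℂ (a x) * (ciL K (h * T / x) : ℂ)‖ ≤ 121 / T ^ 2 := by
      rw [norm_mul, norm_mul, Complex.norm_conj, Complex.norm_real, Real.norm_eq_abs]
      calc ‖a (x + h)‖ * ‖a x‖ * |ciL K (h * T / x)| ≤ 1 * 1 * (121 / T ^ 2) := by
            gcongr
            · exact norm_a_le_one hY ha (by linarith)
            · exact norm_a_le_one hY ha hx
            · exact abs_ciL_le_small hK hT hh hx hxL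
        _ = 121 / T ^ 2 := by ring
    rw [norm_mul, Complex.norm_real, Real.norm_eq_abs]
    calc _ ≤ 121 / T ^ 2 * 1 :=
          mul_le_mul hG (block_weight hρ hh hx.le).1 (abs_nonneg _) (by positivity)
      _ = 121 / T ^ 2 := mul_one _
  · rw [hw0 x hx.le (not_le.1 hxL)]
    simp only [Complex.ofReal_zero, mul_zero, norm_zero]
    positivity

end Small

end Thm61ShiftedPieces

end ConreyIwaniec2002

end Literature.NumberTheory.LFunctions

end
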